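import Summits.QuantumFields.BalabanUV.Beta.GAN24.BornLambdaLineage
import Summits.QuantumFields.BalabanUV.Beta.GAN24.Push3LambdaKernelCells
import Summits.QuantumFields.BalabanUV.Beta.MixedWardPackingFF

/-!
# `BalabanUV.Beta.GAN24.BornLambdaContactCells` — binder row G-an2-4 / (CONV-C), CT-ROUTE, BORNSEC (V8) Λ half (banner leaf-01, OWNER (W1) l.33005), PART 2:
# **THE INSTANCE OF leaf-02's Λ SOCKET AT THE BORN Λ-PIECES — the contact term of every Λ lineage of `BornLambdaLineage` (dressed chain from the birth level minus
# the undressed one-shot response) IS TWO EXPLICIT Λ ONE-GAUGE CELLS, with the route's legs, the route's gauge functions and the born coefficient families plugged in,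
# the coefficient DECAY letter and the TRANSVERSALITY letter DISCHARGED** (`d = 3`: no hypothesis beyond `2 ≤ Lc`, an in-block root and `i < k`)

NOT IN PRINT; OUR BOOKKEEPING (G-an2-4 formalisation swarm → CRUX TEAM (2), leaf prover `b2b-balaban-gan24-formalise-leaf-01`, gen 59).  [folklore] bookkeeping over tree
theorems BY NAME: leaf-02 g47's socket `Push3LambdaKernelCells.contact_lambda_eq_cells` (p285950), PART 1 `BornLambdaLineage` (p286890: the lineage legs and their
pure-gauge difference `legChain_sub_respStep_of_lt`, the born Λ-pieces in units), an2∕leaf-10's transversality `WardLocusStep.divV_SLam_lamCoeffK_E2_eq_zero` ∕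
`WardLocusStencils.divV_SLam_lamCoeffOf_eq_zero`, an2's `abs_lamCoeffK_le` ∕ `abs_lamCoeffOf_le`, the owner's `StencilSlotLam.SLam_smul` ∕ `decays_E2unit`, road P1's
`FibreStrip.unitDecayK_holds`, leaf-01 g57's `exists_legChain_envelope` ∕ `exists_abs_gauge_le`, leaf-12's (N1).  0 `def`, 0 cited facts, 0 `def … : Prop`, 0 sorry.
HONEST FRAMING (cell contract, verbatim): «discharging `BetaPertH` makes Bałaban's UV stability UNCONDITIONAL — a real constructive-QFT result; it is NOT the
continuum limit and NOT the Clay problem.»  HONEST DEPENDENCY (verbatim): «continuum YM on T⁴ ⇐ BetaPertH ∧ nine spine estimates (0/9 proved); BetaPertH ⇐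
(D1) ∧ (D4) ∧ CAP+tail; G-an2-4 gates asym, D1 and NE2/3/4.»
STATUS (owner's RULING R-gan24p1-g20-1, l.33005): the cells' ENVELOPE bounds are off the `hB` path; the cell IDENTITIES stay as sockets of whatever replaces them
(BORNSEC-PLAN v1 after ENGINE-B20).  THIS FILE is identities only — exactly the object BORNSEC v1's Λ half will have to bound.

## What (generic `d` unless marked; in-block root `ρ = toSite rr`)
* §1 COEFFICIENT ALGEBRA: `lamCoeffK_smul_right` (+ d1's `MixedWardPackingFF.divV_smul` BY NAME); the born Λ coefficient families of PART 1 read as ONE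
  coefficient family each (`unitS_freshAt_lam_zero_eq_SLam`, `unitS_freshAt_lam_succ_eq_SLam`); their TRANSVERSALITY `divV_bornLam_zero_eq_zero` ∕ `divV_bornLam_succ_eq_zero`
  (an2∕leaf-10 BY NAME); their DECAY LETTERS `exists_abs_bornLamCoeff_zero_le` and `abs_bornLamCoeff_succ_le_of_unitDecayK` (uniform in `j` under `UnitDecayK`).
* §2 THE SOCKET AT THE LINEAGE LEGS (generic `d`, leg class as hypotheses): **`contact_lineage_lambda_eq_cells`** — for ANY coefficient family under its two letters, the
  contact term of the lineage born at `i < k` (`T_i = legChain (respStepBmSeq ρ Lc) i (k−1−i)` in all three slots vs `B_i = respStep (Lc^i) (Lc^k)` in all three slots,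
  gauge functions `λ_i` of `legChain_sub_respStep_of_lt` in all three slots) = TWO Λ cells (leaf-02's socket; the table term vanishes).
* §3 `d = 3`, NO leg hypothesis: **`contact_lineage_lambda_eq_cells_three`** (the class by `exists_legChain_envelope` ∕ (N1), the gauge bound by `exists_abs_gauge_le`).
* §4 `d = 3`, THE BORN TABLES PLUGGED, NO letter hypothesis: **`contact_bornLam_succ_eq_cells_three`** (birth level `j+1 < k`; `UnitDecayK` by `FibreStrip.unitDecayK_holds`)
  and **`contact_bornLam_zero_eq_cells_three`** (birth level `0 < k`) — the summands of PART 1's `hC` letter, cell by cell.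
Discharges NO slot letter; NO estimate; 0 wall binders; NEVER «G-an2-4 closed»; NOT D1, NOT BetaPertH, NOT continuum, NOT Clay.
-/

noncomputable section

open Finset
open scoped BigOperators
open Literature.MathematicalPhysics.QuantumFieldTheory
open Literature.MathematicalPhysics.QuantumFieldTheory.LatticeForm (quo)
open Literature.MathematicalPhysics.QuantumFieldTheory.Balaban1983to89
open Literature.MathematicalPhysics.QuantumFieldTheory.Balaban1983to89.Beta
open B12Sec2to5 (l1)
open B4ContourShift (supNorm)
open ExpKernelCalculus (MKer Decays VertexFamily Zl Zl_nonneg)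
open AffineAveraging (Site box toSite dz unitVec)
open AveragingHessianKernels (ell)
open AveragingHessianKernelsRooted (hessFFAt biLoc_hessFFAt linKerAt)
open OneStepResolventKernel (Fib LocStencil KInv decays_KInv)
open OneStepKernelFamily (KInvStep decays_KInvStep)
open BalabanStepJetsSucc (E2 lamCoeffK abs_lamCoeffK_le)
open BalabanStepJets (lamCoeffOf abs_lamCoeffOf_le)
open InterLevelTransport (SLam cwsum_apply)
open KernelWard (divV)
open KKTFluctuationKernel (delta1)
open BalabanCompositeJets (respStep)
open Summit.QuantumFields.BalabanUV.Beta.AxialProjectorBlockMean (bmGaugeAt)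
open Summit.QuantumFields.BalabanUV.Beta.HessKerDressedUnits (unitS decays_unitK)
open Summit.QuantumFields.BalabanUV.Beta.GAN24.SrecUnits (KStepUnit_eq)
open Summit.QuantumFields.BalabanUV.Beta.WardLocusStencils (divV_SLam_lamCoeffOf_eq_zero)
open Summit.QuantumFields.BalabanUV.Beta.MixedWardPackingFF (divV_smul)
open Summit.QuantumFields.BalabanUV.Beta.WardLocusStep (divV_SLam_lamCoeffK_E2_eq_zero)
open Summit.QuantumFields.BalabanUV.Beta.GAN24.CombesThomas (sfStep smStep KStepUnit UnitDecayK)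
open Summit.QuantumFields.BalabanUV.Beta.GAN24.StencilSlotLam (SLam_smul decays_E2unit)
open Summit.QuantumFields.BalabanUV.Beta.GAN24.Push4Iter (legChain)
open Summit.QuantumFields.BalabanUV.Beta.GAN24.Push3 (push₃)
open Summit.QuantumFields.BalabanUV.Beta.GAN24.Push3LegTelescope (abs_le_of_env' summable_of_env')
open Summit.QuantumFields.BalabanUV.Beta.GAN24.RespStepBmDecompExact (respStepBmSeq)
open Summit.QuantumFields.BalabanUV.Beta.GAN24.RespStepBmDecompPsi (Psi)
open Summit.QuantumFields.BalabanUV.Beta.GAN24.RespStepBmDecompLegs (legAct)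
open Summit.QuantumFields.BalabanUV.Beta.GAN24.RespStepDecay (exists_respStep_decay_and_grad)
open Summit.QuantumFields.BalabanUV.Beta.GAN24.UndressedResponseUnits (inv_cast_pow_pow)
open Summit.QuantumFields.BalabanUV.Beta.GAN24.DressedLegUnits (exists_abs_gauge_le)
open Summit.QuantumFields.BalabanUV.Beta.GAN24.DressedLegEnvelope (exists_legChain_envelope)
open Summit.QuantumFields.BalabanUV.Beta.GAN24.ContactKernelCells (legAct_delta1_eq)
open Summit.QuantumFields.BalabanUV.Beta.GAN24.FibreStrip (unitDecayK_holds)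
open Summit.QuantumFields.BalabanUV.Beta.GAN24.SrecBornSector (freshAt)
open Summit.QuantumFields.BalabanUV.Beta.GAN24.BornLambdaLineage (unitS_freshAt_lam_zero unitS_freshAt_lam_succ legChain_sub_respStep_of_lt)
open Summit.QuantumFields.BalabanUV.Beta.GAN24.Push3LambdaKernelCells (contact_lambda_eq_cells)

namespace Summit.QuantumFields.BalabanUV.Beta.GAN24.BornLambdaContactCells

variable {d : ℕ} {Lc : ℕ} [NeZero Lc]

/-! ## §1 Coefficient algebra: scalars, transversality and decay of the born Λ coefficient families -/

section Coeff

variable {N : ℕ} [NeZero N]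

omit [NeZero Lc] in
/-- [folklore] A scalar on the Hessian factor of the multiplier response comes out: `lamCoeffK A (s • E) N = s · lamCoeffK A E N`. -/
theorem lamCoeffK_smul_right (A E : MKer (d + 1) (Fib d)) (s : ℝ) (N : ℕ) :
    lamCoeffK A (s • E) N = fun μ y κ u => s * lamCoeffK A E N μ y κ u := by
  funext μ y κ u
  simp only [lamCoeffK, ExpKernelCalculus.comp, Pi.smul_apply, smul_eq_mul]
  rw [← tsum_mul_left]
  refine tsum_congr fun v => ?_
  rw [Finset.mul_sum]
  refine Finset.sum_congr rfl fun f _ => ?_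
  ring

/-- [folklore] **THE BORN Λ-PIECE OF MEMBER `0` IN UNITS AS ONE Λ-PIECE** (the scalar `cΛ` absorbed into the coefficient family; PART 1 + the owner's `SLam_smul`). -/
theorem unitS_freshAt_lam_zero_eq_SLam (ρ : Fin (d + 1) → ℤ) (cΛ : ℝ) :
    unitS (sfStep Lc 0) (smStep d Lc 0) (freshAt Lc ρ 0 cΛ 0)
      = SLam Lc (fun μ y κ u => cΛ * lamCoeffOf (KInv (N := Lc) (d := d)) Lc μ y κ u) (fun μ y => hessFFAt ρ Lc μ y) := by
  rw [unitS_freshAt_lam_zero, SLam_smul]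

/-- [folklore] **THE BORN Λ-PIECE OF MEMBER `j+1` IN UNITS AS ONE Λ-PIECE** (the `j`-free weight `cΛ·Lc^{2(d+1)}` absorbed into the coefficient family). -/
theorem unitS_freshAt_lam_succ_eq_SLam (ρ : Fin (d + 1) → ℤ) (cΛ : ℝ) (j : ℕ) :
    unitS (sfStep Lc (j + 1)) (smStep d Lc (j + 1)) (freshAt Lc ρ 0 cΛ (j + 1))
      = SLam Lc (fun μ y κ u => (cΛ * (Lc : ℝ) ^ (2 * (d + 1))) *
          lamCoeffK (KStepUnit (d := d) Lc (j + 1)) ((smStep d Lc j) ^ 2 • E2 d Lc (j + 1)) Lc μ y κ u) (fun μ y => hessFFAt ρ Lc μ y) := by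
  rw [unitS_freshAt_lam_succ, SLam_smul]

/-- NOT IN PRINT; OUR BOOKKEEPING.  **THE BORN Λ-PIECE OF MEMBER `0` IS TRANSVERSAL** (in-block root): `divV (unitS_0 (freshAt Lc ρ 0 cΛ 0)) u = 0` — an2's
`WardLocusStencils.divV_SLam_lamCoeffOf_eq_zero` BY NAME (`decays_KInv`, an1's rooted `biLoc_hessFFAt`), through the scalar. -/
theorem divV_bornLam_zero_eq_zero {rr : Fin (d + 1) → ℕ} (hrr : rr ∈ box (d + 1) Lc) (cΛ : ℝ) (u : Fin (d + 1) → ℤ) :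
    divV (SLam Lc (fun μ y κ u => cΛ * lamCoeffOf (KInv (N := Lc) (d := d)) Lc μ y κ u) (fun μ y => hessFFAt (toSite rr) Lc μ y)) u = 0 := by
  have hLc : 1 ≤ Lc := Nat.one_le_iff_ne_zero.2 (NeZero.ne Lc)
  obtain ⟨δ₀, C, hδ₀, hC, hdec⟩ := decays_KInv (N := Lc) (d := d)
  have hQ : VertexFamily (fun μ y => hessFFAt (toSite rr) Lc μ y) Lc
      (2 * (ell (d + 1) Lc : ℝ) ^ 2 * Real.exp (4 * ((d : ℝ) + 1) * Lc * δ₀)) δ₀ :=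
    fun μ y => biLoc_hessFFAt hLc μ y hrr hδ₀.le
  rw [SLam_smul, divV_smul, divV_SLam_lamCoeffOf_eq_zero hdec hC hδ₀ hQ u, smul_zero]

/-- [folklore] The unit step resolvent decays (an2's `decays_KInvStep` through asym1's `decays_unitK`; per level — enough for the qualitative transversality). -/
theorem exists_decays_KStepUnit (j : ℕ) : ∃ C m : ℝ, 0 < m ∧ Decays (KStepUnit (d := d) Lc j) C m := by
  obtain ⟨δK, CK, hδK, -, hK⟩ := decays_KInvStep (d := d) (Lc := Lc) j
  exact ⟨_, δK, hδK, by rw [KStepUnit_eq]; exact decays_unitK hK⟩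

/-- NOT IN PRINT; OUR BOOKKEEPING.  **THE BORN Λ-PIECE OF MEMBER `j+1` IS TRANSVERSAL** (in-block root): an2∕leaf-10's `WardLocusStep.divV_SLam_lamCoeffK_E2_eq_zero` BY NAME
at the unit-normalised resolvent `KStepUnit Lc (j+1)`, through the two scalars (`lamCoeffK_smul_right`, `SLam_smul`, `divV_smul`). -/
theorem divV_bornLam_succ_eq_zero {rr : Fin (d + 1) → ℕ} (hrr : rr ∈ box (d + 1) Lc) (cΛ : ℝ) (j : ℕ) (u : Fin (d + 1) → ℤ) :
    divV (SLam Lc (fun μ y κ u => (cΛ * (Lc : ℝ) ^ (2 * (d + 1))) *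
      lamCoeffK (KStepUnit (d := d) Lc (j + 1)) ((smStep d Lc j) ^ 2 • E2 d Lc (j + 1)) Lc μ y κ u) (fun μ y => hessFFAt (toSite rr) Lc μ y)) u = 0 := by
  have hLc : 1 ≤ Lc := Nat.one_le_iff_ne_zero.2 (NeZero.ne Lc)
  obtain ⟨CA, m, hm, hA⟩ := exists_decays_KStepUnit (d := d) (Lc := Lc) (j + 1)
  have hQ : VertexFamily (fun μ y => hessFFAt (toSite rr) Lc μ y) Lc
      (2 * (ell (d + 1) Lc : ℝ) ^ 2 * Real.exp (4 * ((d : ℝ) + 1) * Lc * m)) m :=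
    fun μ y => biLoc_hessFFAt hLc μ y hrr hm.le
  have e : (fun μ y κ u => (cΛ * (Lc : ℝ) ^ (2 * (d + 1))) *
      lamCoeffK (KStepUnit (d := d) Lc (j + 1)) ((smStep d Lc j) ^ 2 • E2 d Lc (j + 1)) Lc μ y κ u)
      = fun μ y κ u => (cΛ * (Lc : ℝ) ^ (2 * (d + 1)) * (smStep d Lc j) ^ 2) *
        lamCoeffK (KStepUnit (d := d) Lc (j + 1)) (E2 d Lc (j + 1)) Lc μ y κ u := by
    funext μ y κ u
    rw [lamCoeffK_smul_right]
    ring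
  rw [e, SLam_smul, divV_smul, divV_SLam_lamCoeffK_E2_eq_zero (Lc := Lc) (j + 1) hA hm hQ hm u, smul_zero]

/-- [folklore] **DECAY LETTER OF THE MEMBER-`0` COEFFICIENTS** (an2's `abs_lamCoeffOf_le` at `decays_KInv`'s data; root-free):
`|cΛ·lamCoeffOf (KInv Lc) Lc μ y κ u| ≤ (|cΛ|·C′)·e^{−δ₀|Lc•y − u|₁}`. -/
theorem exists_abs_bornLamCoeff_zero_le (cΛ : ℝ) :
    ∃ Cc δ : ℝ, 0 < δ ∧ 0 ≤ Cc ∧ ∀ (μ : Fin (d + 1)) (y : Fin (d + 1) → ℤ) (κ : Fin (d + 1)) (u : Fin (d + 1) → ℤ),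
      |cΛ * lamCoeffOf (KInv (N := Lc) (d := d)) Lc μ y κ u| ≤ Cc * Real.exp (-δ * l1 ((Lc : ℤ) • y - u)) := by
  obtain ⟨δ₀, C, hδ₀, hC, hdec⟩ := decays_KInv (N := Lc) (d := d)
  have hc := abs_lamCoeffOf_le (N := Lc) hdec hC hδ₀.le
  refine ⟨|cΛ| * ((3 : ℝ) ^ (d + 1) * ((d + 1 : ℕ) : ℝ) * (16 * ((d + 1 : ℕ) : ℝ)) * C * Real.exp (((d + 1 : ℕ) : ℝ) * δ₀)), δ₀, hδ₀,
    by positivity, fun μ y κ u => ?_⟩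
  rw [abs_mul, mul_assoc]
  exact mul_le_mul_of_nonneg_left (hc μ y κ u) (abs_nonneg _)

/-- [folklore] **DECAY LETTER OF THE MEMBER-`(j+1)` COEFFICIENTS, UNIFORM IN `j`, FROM THE K-SLOT'S UNIT DECAY** (an2's `abs_lamCoeffK_le` at
`UnitDecayK`'s data and the owner's `decays_E2unit`): `|(cΛ·Lc^{2(d+1)})·lamCoeffK (KStepUnit Lc (j+1)) ((smStep j)² • E2 (j+1)) Lc μ y κ u| ≤ Cc·e^{−(δ∕2)|Lc•y − u|₁}`,
ONE `Cc` for all `j`. -/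
theorem abs_bornLamCoeff_succ_le_of_unitDecayK {CK δK : ℝ} (hK : UnitDecayK d Lc (sfStep Lc) (smStep d Lc) CK δK) (hδK : 0 < δK) (cΛ : ℝ) (j : ℕ)
    (μ : Fin (d + 1)) (y : Fin (d + 1) → ℤ) (κ : Fin (d + 1)) (u : Fin (d + 1) → ℤ) :
    |(cΛ * (Lc : ℝ) ^ (2 * (d + 1))) * lamCoeffK (KStepUnit (d := d) Lc (j + 1)) ((smStep d Lc j) ^ 2 • E2 d Lc (j + 1)) Lc μ y κ u|
      ≤ (|cΛ * (Lc : ℝ) ^ (2 * (d + 1))| * ((Fintype.card (Fib d) : ℝ) * (CK * CK) * Zl (d + 1) (δK - δK / 2)))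
        * Real.exp (-(δK / 2) * l1 ((Lc : ℤ) • y - u)) := by
  have hA : Decays (KStepUnit (d := d) Lc (j + 1)) CK δK := hK (j + 1)
  have hE : Decays ((smStep d Lc j) ^ 2 • E2 d Lc (j + 1)) CK δK := decays_E2unit (hK j) hδK.le
  have hc := abs_lamCoeffK_le hA hE hδK Lc μ y κ u
  rw [abs_mul, mul_assoc]
  exact mul_le_mul_of_nonneg_left hc (abs_nonneg _)

end Coeff

/-! ## §2 leaf-02's Λ socket at the lineage legs (generic `d`; leg class as hypotheses) -/

section Socket

variable {rr : Fin (d + 1) → ℕ} {c : Fin (d + 1) → (Fin (d + 1) → ℤ) → Fin (d + 1) → (Fin (d + 1) → ℤ) → ℝ} {Cc δ CT CB Clam : ℝ} {i k : ℕ}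

/-- NOT IN PRINT; OUR BOOKKEEPING.  **THE CONTACT TERM OF THE Λ LINEAGE BORN AT `i < k` IS TWO Λ ONE-GAUGE CELLS** (generic `d`; in-block root; ANY coefficient family
under `hc` ∕ `hdiv`; `T_i = legChain (respStepBmSeq ρ Lc) i (k−1−i)` and `B_i = respStep (Lc^i) (Lc^k)` BOUNDED with SUMMABLE fine slices, `λ_i` BOUNDED): leaf-02's
`contact_lambda_eq_cells` with `lᴱ = rᴱ = wᴱ = T_i`, `lᴮ = rᴮ = wᴮ = B_i`, `λ_L = λ_R = λ_W = λ_i` (PART 1's `legChain_sub_respStep_of_lt` three times). -/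
theorem contact_lineage_lambda_eq_cells (hrr : rr ∈ box (d + 1) Lc) (hik : i < k)
    (hc : ∀ μ y κ u, |c μ y κ u| ≤ Cc * Real.exp (-δ * l1 ((Lc : ℤ) • y - u))) (hδ : 0 < δ) (hCc : 0 ≤ Cc)
    (hdiv : ∀ u, divV (SLam Lc c (fun μ y => hessFFAt (toSite rr) Lc μ y)) u = 0)
    (hT : ∀ μ z κ u, |legChain (respStepBmSeq (d := d) (toSite rr) Lc) i (k - 1 - i) μ z κ u| ≤ CT)
    (hTs : ∀ μ z κ, Summable fun u => legChain (respStepBmSeq (d := d) (toSite rr) Lc) i (k - 1 - i) μ z κ u)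
    (hB : ∀ μ z κ u, |respStep (d := d) (Lc ^ i) (Lc ^ k) μ z κ u| ≤ CB)
    (hBs : ∀ μ z κ, Summable fun u => respStep (d := d) (Lc ^ i) (Lc ^ k) μ z κ u)
    (hlam : ∀ μ z u, |(Psi (toSite rr) Lc i (k - 1 - i) (delta1 μ z) - bmGaugeAt (toSite rr) (respStep (d := d) (Lc ^ i) (Lc ^ k) μ z) Lc) u| ≤ Clam)
    (κ' : Fin (d + 1)) (u' x' z' : Fin (d + 1) → ℤ) (α β : Fin (d + 1)) :
    push₃ (legChain (respStepBmSeq (d := d) (toSite rr) Lc) i (k - 1 - i)) (legChain (respStepBmSeq (d := d) (toSite rr) Lc) i (k - 1 - i))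
        (legChain (respStepBmSeq (d := d) (toSite rr) Lc) i (k - 1 - i)) (SLam Lc c (fun μ y => hessFFAt (toSite rr) Lc μ y)) κ' u' x' z' (Sum.inl α) (Sum.inl β)
      - push₃ (respStep (d := d) (Lc ^ i) (Lc ^ k)) (respStep (d := d) (Lc ^ i) (Lc ^ k)) (respStep (d := d) (Lc ^ i) (Lc ^ k))
        (SLam Lc c (fun μ y => hessFFAt (toSite rr) Lc μ y)) κ' u' x' z' (Sum.inl α) (Sum.inl β)
      = (∑' z, ∑ b, legChain (respStepBmSeq (d := d) (toSite rr) Lc) i (k - 1 - i) β z' b z *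
            ∑' u, ∑ κ, legChain (respStepBmSeq (d := d) (toSite rr) Lc) i (k - 1 - i) κ' u' κ u *
            -(∑ μ, ∑' y, c μ y κ u *
              (((Psi (toSite rr) Lc i (k - 1 - i) (delta1 α x') - bmGaugeAt (toSite rr) (respStep (d := d) (Lc ^ i) (Lc ^ k) α x') Lc) z
                + (Psi (toSite rr) Lc i (k - 1 - i) (delta1 α x') - bmGaugeAt (toSite rr) (respStep (d := d) (Lc ^ i) (Lc ^ k) α x') Lc) (z + unitVec b)
                - (Psi (toSite rr) Lc i (k - 1 - i) (delta1 α x') - bmGaugeAt (toSite rr) (respStep (d := d) (Lc ^ i) (Lc ^ k) α x') Lc) ((Lc : ℤ) • y + toSite rr)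
                - (Psi (toSite rr) Lc i (k - 1 - i) (delta1 α x') - bmGaugeAt (toSite rr) (respStep (d := d) (Lc ^ i) (Lc ^ k) α x') Lc)
                    ((Lc : ℤ) • y + toSite rr + (Lc : ℤ) • unitVec μ))
                * linKerAt (toSite rr) Lc μ y (b, z) / 2)))
        - (∑' x, ∑ a, respStep (d := d) (Lc ^ i) (Lc ^ k) α x' a x *
            ∑' u, ∑ κ, legChain (respStepBmSeq (d := d) (toSite rr) Lc) i (k - 1 - i) κ' u' κ u *
            -(∑ μ, ∑' y, c μ y κ u *
              (((Psi (toSite rr) Lc i (k - 1 - i) (delta1 β z') - bmGaugeAt (toSite rr) (respStep (d := d) (Lc ^ i) (Lc ^ k) β z') Lc) x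
                + (Psi (toSite rr) Lc i (k - 1 - i) (delta1 β z') - bmGaugeAt (toSite rr) (respStep (d := d) (Lc ^ i) (Lc ^ k) β z') Lc) (x + unitVec a)
                - (Psi (toSite rr) Lc i (k - 1 - i) (delta1 β z') - bmGaugeAt (toSite rr) (respStep (d := d) (Lc ^ i) (Lc ^ k) β z') Lc) ((Lc : ℤ) • y + toSite rr)
                - (Psi (toSite rr) Lc i (k - 1 - i) (delta1 β z') - bmGaugeAt (toSite rr) (respStep (d := d) (Lc ^ i) (Lc ^ k) β z') Lc)
                    ((Lc : ℤ) • y + toSite rr + (Lc : ℤ) • unitVec μ))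
                * linKerAt (toSite rr) Lc μ y (a, x) / 2))) := by
  have hLc : 1 ≤ Lc := Nat.one_le_iff_ne_zero.2 (NeZero.ne Lc)
  have hg := legChain_sub_respStep_of_lt (d := d) hrr hik
  exact contact_lambda_eq_cells hLc hrr hc hδ hCc hdiv hT hTs hB hBs hT hTs hB hBs hT hB hg hg hg hlam κ' u' x' z' α β

end Socket

/-! ## §3 `d = 3`: the leg class and the gauge bound discharged -/

section Three

variable {Lc : ℕ} [NeZero Lc] {rr : Fin (3 + 1) → ℕ} {c : Fin (3 + 1) → (Fin (3 + 1) → ℤ) → Fin (3 + 1) → (Fin (3 + 1) → ℤ) → ℝ} {Cc δ : ℝ} {i k : ℕ}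

/-- [folklore] The route's gauge functions are bounded (leaf-01 g57's `exists_abs_gauge_le` at the point datum `delta1 μ z`, `|delta1| ≤ 1`). -/
theorem exists_abs_lineageGauge_le (hLc : 2 ≤ Lc) :
    ∃ K : ℝ, 0 ≤ K ∧ ∀ (rr : Fin (3 + 1) → ℕ), rr ∈ box (3 + 1) Lc → ∀ (m n : ℕ) (μ : Fin (3 + 1)) (z u : Site (3 + 1)),
      |(Psi (toSite rr) Lc m n (delta1 μ z) - bmGaugeAt (toSite rr) (respStep (d := 3) (Lc ^ m) (Lc ^ (m + n + 1)) μ z) Lc) u|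
        ≤ K * ((Lc : ℝ) ^ (4 * (n + 1)))⁻¹ := by
  obtain ⟨K, hK, h⟩ := exists_abs_gauge_le (Lc := Lc) hLc
  refine ⟨K, hK, fun rr hrr m n μ z u => ?_⟩
  have hb : ∀ μ' y, |delta1 (d := 3) μ z μ' y| ≤ 1 := fun μ' y => by
    unfold delta1
    split_ifs <;> simp
  have h1 := h rr hrr m n (delta1 μ z) 1 hb u
  rw [legAct_delta1_eq] at h1
  simpa using h1

/-- NOT IN PRINT; OUR BOOKKEEPING.  **THE CONTACT TERM OF THE Λ LINEAGE BORN AT `i < k` IS TWO Λ ONE-GAUGE CELLS — `d = 3`, NO hypothesis on the legs** (`2 ≤ Lc`,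
in-block root; ANY coefficient family under `hc`, `hdiv`): the leg class by leaf-01 g57's `exists_legChain_envelope` (dressed) and leaf-12's (N1)
`exists_respStep_decay_and_grad` (undressed) through `Push3LegTelescope.abs_le_of_env' ∕ summable_of_env'`, the gauge bound by `exists_abs_lineageGauge_le`. -/
theorem contact_lineage_lambda_eq_cells_three (hLc : 2 ≤ Lc) (hrr : rr ∈ box (3 + 1) Lc) (hik : i < k)
    (hc : ∀ μ y κ u, |c μ y κ u| ≤ Cc * Real.exp (-δ * l1 ((Lc : ℤ) • y - u))) (hδ : 0 < δ) (hCc : 0 ≤ Cc)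
    (hdiv : ∀ u, divV (SLam Lc c (fun μ y => hessFFAt (toSite rr) Lc μ y)) u = 0)
    (κ' : Fin (3 + 1)) (u' x' z' : Fin (3 + 1) → ℤ) (α β : Fin (3 + 1)) :
    push₃ (legChain (respStepBmSeq (d := 3) (toSite rr) Lc) i (k - 1 - i)) (legChain (respStepBmSeq (d := 3) (toSite rr) Lc) i (k - 1 - i))
        (legChain (respStepBmSeq (d := 3) (toSite rr) Lc) i (k - 1 - i)) (SLam Lc c (fun μ y => hessFFAt (toSite rr) Lc μ y)) κ' u' x' z' (Sum.inl α) (Sum.inl β)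
      - push₃ (respStep (d := 3) (Lc ^ i) (Lc ^ k)) (respStep (d := 3) (Lc ^ i) (Lc ^ k)) (respStep (d := 3) (Lc ^ i) (Lc ^ k))
        (SLam Lc c (fun μ y => hessFFAt (toSite rr) Lc μ y)) κ' u' x' z' (Sum.inl α) (Sum.inl β)
      = (∑' z, ∑ b, legChain (respStepBmSeq (d := 3) (toSite rr) Lc) i (k - 1 - i) β z' b z *
            ∑' u, ∑ κ, legChain (respStepBmSeq (d := 3) (toSite rr) Lc) i (k - 1 - i) κ' u' κ u *
            -(∑ μ, ∑' y, c μ y κ u *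
              (((Psi (toSite rr) Lc i (k - 1 - i) (delta1 α x') - bmGaugeAt (toSite rr) (respStep (d := 3) (Lc ^ i) (Lc ^ k) α x') Lc) z
                + (Psi (toSite rr) Lc i (k - 1 - i) (delta1 α x') - bmGaugeAt (toSite rr) (respStep (d := 3) (Lc ^ i) (Lc ^ k) α x') Lc) (z + unitVec b)
                - (Psi (toSite rr) Lc i (k - 1 - i) (delta1 α x') - bmGaugeAt (toSite rr) (respStep (d := 3) (Lc ^ i) (Lc ^ k) α x') Lc) ((Lc : ℤ) • y + toSite rr)
                - (Psi (toSite rr) Lc i (k - 1 - i) (delta1 α x') - bmGaugeAt (toSite rr) (respStep (d := 3) (Lc ^ i) (Lc ^ k) α x') Lc)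
                    ((Lc : ℤ) • y + toSite rr + (Lc : ℤ) • unitVec μ))
                * linKerAt (toSite rr) Lc μ y (b, z) / 2)))
        - (∑' x, ∑ a, respStep (d := 3) (Lc ^ i) (Lc ^ k) α x' a x *
            ∑' u, ∑ κ, legChain (respStepBmSeq (d := 3) (toSite rr) Lc) i (k - 1 - i) κ' u' κ u *
            -(∑ μ, ∑' y, c μ y κ u *
              (((Psi (toSite rr) Lc i (k - 1 - i) (delta1 β z') - bmGaugeAt (toSite rr) (respStep (d := 3) (Lc ^ i) (Lc ^ k) β z') Lc) x
                + (Psi (toSite rr) Lc i (k - 1 - i) (delta1 β z') - bmGaugeAt (toSite rr) (respStep (d := 3) (Lc ^ i) (Lc ^ k) β z') Lc) (x + unitVec a)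
                - (Psi (toSite rr) Lc i (k - 1 - i) (delta1 β z') - bmGaugeAt (toSite rr) (respStep (d := 3) (Lc ^ i) (Lc ^ k) β z') Lc) ((Lc : ℤ) • y + toSite rr)
                - (Psi (toSite rr) Lc i (k - 1 - i) (delta1 β z') - bmGaugeAt (toSite rr) (respStep (d := 3) (Lc ^ i) (Lc ^ k) β z') Lc)
                    ((Lc : ℤ) • y + toSite rr + (Lc : ℤ) • unitVec μ))
                * linKerAt (toSite rr) Lc μ y (a, x) / 2))) := by
  have hk : i + (k - 1 - i) + 1 = k := by omega
  have hL1 : 1 ≤ Lc ^ ((k - 1 - i) + 1) := Nat.one_le_pow _ _ (Nat.pos_of_ne_zero (NeZero.ne Lc))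
  obtain ⟨κE, KE, hκE, -, hE⟩ := exists_legChain_envelope (Lc := Lc) hLc
  obtain ⟨κB, C, -, hκB, -, -, hN1, -⟩ := exists_respStep_decay_and_grad (Lc := Lc)
  obtain ⟨Klam, -, hKlam⟩ := exists_abs_lineageGauge_le (Lc := Lc) hLc
  have hEnv : ∀ μ y κ u, |legChain (respStepBmSeq (d := 3) (toSite rr) Lc) i (k - 1 - i) μ y κ u|
      ≤ KE * ((Lc : ℝ) ^ (4 * ((k - 1 - i) + 1)))⁻¹ * Real.exp (-(κE * supNorm (quo (Lc ^ ((k - 1 - i) + 1)) u - y))) :=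
    fun μ y κ u => hE rr hrr i (k - 1 - i) μ y κ u
  have hBnv : ∀ μ y κ u, |respStep (d := 3) (Lc ^ i) (Lc ^ k) μ y κ u|
      ≤ C * ((Lc : ℝ) ^ ((3 + 2) * ((k - 1 - i) + 1)))⁻¹ * Real.exp (-(κB * supNorm (quo (Lc ^ ((k - 1 - i) + 1)) u - y))) := by
    intro μ y κ u
    have h := hN1 i (k - 1 - i) μ y κ u
    rw [inv_cast_pow_pow, hk] at h
    exact h
  have hlam : ∀ μ z u, |(Psi (toSite rr) Lc i (k - 1 - i) (delta1 μ z)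
      - bmGaugeAt (toSite rr) (respStep (d := 3) (Lc ^ i) (Lc ^ k) μ z) Lc) u| ≤ Klam * ((Lc : ℝ) ^ (4 * ((k - 1 - i) + 1)))⁻¹ := by
    intro μ z u
    have h := hKlam rr hrr i (k - 1 - i) μ z u
    rw [hk] at h
    exact h
  exact contact_lineage_lambda_eq_cells (d := 3) hrr hik hc hδ hCc hdiv (abs_le_of_env' hκE.le hEnv) (summable_of_env' hL1 hκE hEnv)
    (abs_le_of_env' hκB.le hBnv) (summable_of_env' hL1 hκB hBnv) hlam κ' u' x' z' α β

end Three

/-! ## §4 `d = 3`: the born Λ-pieces plugged — the summands of PART 1's contact letter `hC`, cell by cell, no letter hypothesis -/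

section Born

variable {Lc : ℕ} [NeZero Lc] {rr : Fin (3 + 1) → ℕ}

/-- NOT IN PRINT; OUR BOOKKEEPING ((V6)-Λ INSTANCE at the born table of member `j+1`; `d = 3`, `2 ≤ Lc`, in-block root, `j + 1 < k`; NO other hypothesis).
**THE CONTACT TERM OF THE Λ LINEAGE BORN AT LEVEL `j+1` IS TWO EXPLICIT Λ ONE-GAUGE CELLS**: the table is PART 1's `unitS_{j+1} (freshAt Lc ρ 0 cΛ (j+1))` (= the Λ-piece
with coefficients `c = (cΛ·Lc^{2(d+1)}) · lamCoeffK (KStepUnit Lc (j+1)) ((smStep j)² • E2 (j+1)) Lc`), its decay letter by road P1's `FibreStrip.unitDecayK_holds` (§1), its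
transversality by an2∕leaf-10 (§1); legs and gauge functions as in §3. -/
theorem contact_bornLam_succ_eq_cells_three (hLc : 2 ≤ Lc) (hrr : rr ∈ box (3 + 1) Lc) (cΛ : ℝ) {j k : ℕ} (hjk : j + 1 < k)
    (κ' : Fin (3 + 1)) (u' x' z' : Fin (3 + 1) → ℤ) (α β : Fin (3 + 1)) :
    push₃ (legChain (respStepBmSeq (d := 3) (toSite rr) Lc) (j + 1) (k - 1 - (j + 1))) (legChain (respStepBmSeq (d := 3) (toSite rr) Lc) (j + 1) (k - 1 - (j + 1)))
        (legChain (respStepBmSeq (d := 3) (toSite rr) Lc) (j + 1) (k - 1 - (j + 1)))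
        (unitS (sfStep Lc (j + 1)) (smStep 3 Lc (j + 1)) (freshAt Lc (toSite rr) 0 cΛ (j + 1))) κ' u' x' z' (Sum.inl α) (Sum.inl β)
      - push₃ (respStep (d := 3) (Lc ^ (j + 1)) (Lc ^ k)) (respStep (d := 3) (Lc ^ (j + 1)) (Lc ^ k)) (respStep (d := 3) (Lc ^ (j + 1)) (Lc ^ k))
        (unitS (sfStep Lc (j + 1)) (smStep 3 Lc (j + 1)) (freshAt Lc (toSite rr) 0 cΛ (j + 1))) κ' u' x' z' (Sum.inl α) (Sum.inl β)
      = (∑' z, ∑ b, legChain (respStepBmSeq (d := 3) (toSite rr) Lc) (j + 1) (k - 1 - (j + 1)) β z' b z *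
            ∑' u, ∑ κ, legChain (respStepBmSeq (d := 3) (toSite rr) Lc) (j + 1) (k - 1 - (j + 1)) κ' u' κ u *
            -(∑ μ, ∑' y, ((cΛ * (Lc : ℝ) ^ (2 * (3 + 1))) *
                lamCoeffK (KStepUnit (d := 3) Lc (j + 1)) ((smStep 3 Lc j) ^ 2 • E2 3 Lc (j + 1)) Lc μ y κ u) *
              (((Psi (toSite rr) Lc (j + 1) (k - 1 - (j + 1)) (delta1 α x') - bmGaugeAt (toSite rr) (respStep (d := 3) (Lc ^ (j + 1)) (Lc ^ k) α x') Lc) z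
                + (Psi (toSite rr) Lc (j + 1) (k - 1 - (j + 1)) (delta1 α x') - bmGaugeAt (toSite rr) (respStep (d := 3) (Lc ^ (j + 1)) (Lc ^ k) α x') Lc)
                    (z + unitVec b)
                - (Psi (toSite rr) Lc (j + 1) (k - 1 - (j + 1)) (delta1 α x') - bmGaugeAt (toSite rr) (respStep (d := 3) (Lc ^ (j + 1)) (Lc ^ k) α x') Lc)
                    ((Lc : ℤ) • y + toSite rr)
                - (Psi (toSite rr) Lc (j + 1) (k - 1 - (j + 1)) (delta1 α x') - bmGaugeAt (toSite rr) (respStep (d := 3) (Lc ^ (j + 1)) (Lc ^ k) α x') Lc)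
                    ((Lc : ℤ) • y + toSite rr + (Lc : ℤ) • unitVec μ))
                * linKerAt (toSite rr) Lc μ y (b, z) / 2)))
        - (∑' x, ∑ a, respStep (d := 3) (Lc ^ (j + 1)) (Lc ^ k) α x' a x *
            ∑' u, ∑ κ, legChain (respStepBmSeq (d := 3) (toSite rr) Lc) (j + 1) (k - 1 - (j + 1)) κ' u' κ u *
            -(∑ μ, ∑' y, ((cΛ * (Lc : ℝ) ^ (2 * (3 + 1))) *
                lamCoeffK (KStepUnit (d := 3) Lc (j + 1)) ((smStep 3 Lc j) ^ 2 • E2 3 Lc (j + 1)) Lc μ y κ u) *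
              (((Psi (toSite rr) Lc (j + 1) (k - 1 - (j + 1)) (delta1 β z') - bmGaugeAt (toSite rr) (respStep (d := 3) (Lc ^ (j + 1)) (Lc ^ k) β z') Lc) x
                + (Psi (toSite rr) Lc (j + 1) (k - 1 - (j + 1)) (delta1 β z') - bmGaugeAt (toSite rr) (respStep (d := 3) (Lc ^ (j + 1)) (Lc ^ k) β z') Lc)
                    (x + unitVec a)
                - (Psi (toSite rr) Lc (j + 1) (k - 1 - (j + 1)) (delta1 β z') - bmGaugeAt (toSite rr) (respStep (d := 3) (Lc ^ (j + 1)) (Lc ^ k) β z') Lc)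
                    ((Lc : ℤ) • y + toSite rr)
                - (Psi (toSite rr) Lc (j + 1) (k - 1 - (j + 1)) (delta1 β z') - bmGaugeAt (toSite rr) (respStep (d := 3) (Lc ^ (j + 1)) (Lc ^ k) β z') Lc)
                    ((Lc : ℤ) • y + toSite rr + (Lc : ℤ) • unitVec μ))
                * linKerAt (toSite rr) Lc μ y (a, x) / 2))) := by
  obtain ⟨κ, hκ, Cst, hK⟩ := unitDecayK_holds (Lc := Lc)
  have hL0 : (0 : ℝ) < (Lc : ℝ) := by exact_mod_cast Nat.pos_of_ne_zero (NeZero.ne Lc)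
  have hrate : 0 < κ / ((3 + 1) * (Lc : ℝ)) := by positivity
  have hrate2 : 0 < κ / ((3 + 1) * (Lc : ℝ)) / 2 := by positivity
  have hsq : 0 ≤ Cst * Real.exp (2 * κ) * (Cst * Real.exp (2 * κ)) := mul_self_nonneg _
  have hCc : 0 ≤ |cΛ * (Lc : ℝ) ^ (2 * (3 + 1))| * ((Fintype.card (Fib 3) : ℝ) * (Cst * Real.exp (2 * κ) * (Cst * Real.exp (2 * κ)))
      * Zl (3 + 1) (κ / ((3 + 1) * (Lc : ℝ)) - κ / ((3 + 1) * (Lc : ℝ)) / 2)) := by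
    have hz : 0 ≤ Zl (3 + 1) (κ / ((3 + 1) * (Lc : ℝ)) - κ / ((3 + 1) * (Lc : ℝ)) / 2) := Zl_nonneg (by linarith)
    positivity
  rw [unitS_freshAt_lam_succ_eq_SLam]
  exact contact_lineage_lambda_eq_cells_three hLc hrr hjk (abs_bornLamCoeff_succ_le_of_unitDecayK (d := 3) hK hrate cΛ j) hrate2 hCc
    (divV_bornLam_succ_eq_zero hrr cΛ j) κ' u' x' z' α β

/-- NOT IN PRINT; OUR BOOKKEEPING ((V6)-Λ INSTANCE at the born table of member `0`; `d = 3`, `2 ≤ Lc`, in-block root, `0 < k`; NO other hypothesis).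
**THE CONTACT TERM OF THE Λ LINEAGE BORN AT LEVEL `0` IS TWO EXPLICIT Λ ONE-GAUGE CELLS**: the table is PART 1's `unitS_0 (freshAt Lc ρ 0 cΛ 0)` (coefficients
`c = cΛ · lamCoeffOf (KInv Lc) Lc`), its decay letter by an2's `abs_lamCoeffOf_le`, its transversality by an2's `divV_SLam_lamCoeffOf_eq_zero` (§1). -/
theorem contact_bornLam_zero_eq_cells_three (hLc : 2 ≤ Lc) (hrr : rr ∈ box (3 + 1) Lc) (cΛ : ℝ) {k : ℕ} (hk : 0 < k)
    (κ' : Fin (3 + 1)) (u' x' z' : Fin (3 + 1) → ℤ) (α β : Fin (3 + 1)) :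
    push₃ (legChain (respStepBmSeq (d := 3) (toSite rr) Lc) 0 (k - 1 - 0)) (legChain (respStepBmSeq (d := 3) (toSite rr) Lc) 0 (k - 1 - 0))
        (legChain (respStepBmSeq (d := 3) (toSite rr) Lc) 0 (k - 1 - 0))
        (unitS (sfStep Lc 0) (smStep 3 Lc 0) (freshAt Lc (toSite rr) 0 cΛ 0)) κ' u' x' z' (Sum.inl α) (Sum.inl β)
      - push₃ (respStep (d := 3) (Lc ^ 0) (Lc ^ k)) (respStep (d := 3) (Lc ^ 0) (Lc ^ k)) (respStep (d := 3) (Lc ^ 0) (Lc ^ k))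
        (unitS (sfStep Lc 0) (smStep 3 Lc 0) (freshAt Lc (toSite rr) 0 cΛ 0)) κ' u' x' z' (Sum.inl α) (Sum.inl β)
      = (∑' z, ∑ b, legChain (respStepBmSeq (d := 3) (toSite rr) Lc) 0 (k - 1 - 0) β z' b z *
            ∑' u, ∑ κ, legChain (respStepBmSeq (d := 3) (toSite rr) Lc) 0 (k - 1 - 0) κ' u' κ u *
            -(∑ μ, ∑' y, (cΛ * lamCoeffOf (KInv (N := Lc) (d := 3)) Lc μ y κ u) *
              (((Psi (toSite rr) Lc 0 (k - 1 - 0) (delta1 α x') - bmGaugeAt (toSite rr) (respStep (d := 3) (Lc ^ 0) (Lc ^ k) α x') Lc) z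
                + (Psi (toSite rr) Lc 0 (k - 1 - 0) (delta1 α x') - bmGaugeAt (toSite rr) (respStep (d := 3) (Lc ^ 0) (Lc ^ k) α x') Lc) (z + unitVec b)
                - (Psi (toSite rr) Lc 0 (k - 1 - 0) (delta1 α x') - bmGaugeAt (toSite rr) (respStep (d := 3) (Lc ^ 0) (Lc ^ k) α x') Lc) ((Lc : ℤ) • y + toSite rr)
                - (Psi (toSite rr) Lc 0 (k - 1 - 0) (delta1 α x') - bmGaugeAt (toSite rr) (respStep (d := 3) (Lc ^ 0) (Lc ^ k) α x') Lc)
                    ((Lc : ℤ) • y + toSite rr + (Lc : ℤ) • unitVec μ))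
                * linKerAt (toSite rr) Lc μ y (b, z) / 2)))
        - (∑' x, ∑ a, respStep (d := 3) (Lc ^ 0) (Lc ^ k) α x' a x *
            ∑' u, ∑ κ, legChain (respStepBmSeq (d := 3) (toSite rr) Lc) 0 (k - 1 - 0) κ' u' κ u *
            -(∑ μ, ∑' y, (cΛ * lamCoeffOf (KInv (N := Lc) (d := 3)) Lc μ y κ u) *
              (((Psi (toSite rr) Lc 0 (k - 1 - 0) (delta1 β z') - bmGaugeAt (toSite rr) (respStep (d := 3) (Lc ^ 0) (Lc ^ k) β z') Lc) x
                + (Psi (toSite rr) Lc 0 (k - 1 - 0) (delta1 β z') - bmGaugeAt (toSite rr) (respStep (d := 3) (Lc ^ 0) (Lc ^ k) β z') Lc) (x + unitVec a)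
                - (Psi (toSite rr) Lc 0 (k - 1 - 0) (delta1 β z') - bmGaugeAt (toSite rr) (respStep (d := 3) (Lc ^ 0) (Lc ^ k) β z') Lc) ((Lc : ℤ) • y + toSite rr)
                - (Psi (toSite rr) Lc 0 (k - 1 - 0) (delta1 β z') - bmGaugeAt (toSite rr) (respStep (d := 3) (Lc ^ 0) (Lc ^ k) β z') Lc)
                    ((Lc : ℤ) • y + toSite rr + (Lc : ℤ) • unitVec μ))
                * linKerAt (toSite rr) Lc μ y (a, x) / 2))) := by
  obtain ⟨Cc, δ, hδ, hCc, hc⟩ := exists_abs_bornLamCoeff_zero_le (d := 3) (Lc := Lc) cΛ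
  rw [unitS_freshAt_lam_zero_eq_SLam]
  exact contact_lineage_lambda_eq_cells_three hLc hrr hk hc hδ hCc (divV_bornLam_zero_eq_zero hrr cΛ) κ' u' x' z' α β

end Born

end Summit.QuantumFields.BalabanUV.Beta.GAN24.BornLambdaContactCells

end
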